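import Summits.KontsevichZagierPeriods.KontsevichZagierPeriods.Theorems.FurushoPentagonStuffleInKZDefs

/-!
# `StuffleInKZ` (stmt-KontsevichZagierPeriods-3931), line `cumulative-cube-lattice-paths`:
# combinatorics of the lattice paths (stub `stub_pathsCombinatorics`)

`paths k l` (objects file `FurushoPentagonStuffleInKZDefs.lean`) enumerates the lattice paths
`(0,0) → (k,l)` with steps `X = (1,0)`, `Y = (0,1)`, `D = (1,1)` in Hoffman's HEAD-recursive order
(first step `X`, then `Y`, then `D` — the order of `MZV.stuffle`).  The cube kernel identity of the
line is proved by the LAST-STEP recursion, which holds only up to permutation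
(`paths 1 1 = [XY, YX, D]` versus `[YX, XY, D]`).  This file proves

1. the endpoint characterisation `p ∈ paths k l ↔ cx p = k ∧ cy p = l` (`cx = #X + #D`,
   `cy = #Y + #D`);
2. `(paths k l).Nodup`;
3. the last-step decomposition up to permutation
   `paths (k+1) (l+1) ~ (paths k (l+1))·X ++ (paths (k+1) l)·Y ++ (paths k l)·D`
   (both sides are duplicate-free with the same members, `List.perm_ext_iff_of_nodup`).

References: M. Hoffman, *The algebra of multiple harmonic series*, J. Algebra 194 (1997) §2.
-/

namespace Summit.KontsevichZagierPeriods.FurushoPentagon.StuffleInKZ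

/-! ### The endpoint of an enumerated path -/

/-- Every enumerated path ends at `(k,l)`: `p ∈ paths k l → cx p = k ∧ cy p = l`
(induction along Hoffman's recursion). [folklore] -/
theorem cx_cy_of_mem_paths : ∀ (k l : ℕ) (p : List Step), p ∈ paths k l → cx p = k ∧ cy p = l
  | 0, l, p, hp => by
      rw [paths_zero_left, List.mem_singleton] at hp
      subst hp
      simp [cx, cy, List.count_replicate]
  | k + 1, 0, p, hp => by
      rw [paths_succ_zero, List.mem_singleton] at hp
      subst hp
      simp [cx, cy, List.count_replicate]
  | k + 1, l + 1, p, hp => by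
      rw [paths_succ_succ] at hp
      simp only [List.mem_append, List.mem_map] at hp
      rcases hp with ⟨q, hq, rfl⟩ | ⟨q, hq, rfl⟩ | ⟨q, hq, rfl⟩
      · obtain ⟨h1, h2⟩ := cx_cy_of_mem_paths k (l + 1) q hq
        simp [h1, h2]
      · obtain ⟨h1, h2⟩ := cx_cy_of_mem_paths (k + 1) l q hq
        simp [h1, h2]
      · obtain ⟨h1, h2⟩ := cx_cy_of_mem_paths k l q hq
        simp [h1, h2]

/-- Every step list ending at `(k,l)` is enumerated: `cx p = k → cy p = l → p ∈ paths k l`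
(induction on the list, following its head letter). [folklore] -/
theorem mem_paths_of_cx_cy : ∀ (p : List Step) (k l : ℕ), cx p = k → cy p = l → p ∈ paths k l
  | [], k, l, hk, hl => by
      subst hk; subst hl
      simp
  | Step.X :: p, 0, _, hk, _ => by simp at hk
  | Step.X :: p, k + 1, 0, hk, hl => by
      have ih := mem_paths_of_cx_cy p k 0 (by simpa using hk) (by simpa using hl)
      rw [paths_zero_right, List.mem_singleton] at ih
      subst ih
      simp [List.replicate_succ]
  | Step.X :: p, k + 1, l + 1, hk, hl => by
      have ih := mem_paths_of_cx_cy p k (l + 1) (by simpa using hk) (by simpa using hl)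
      rw [paths_succ_succ]
      exact List.mem_append_left _ (List.mem_map.2 ⟨p, ih, rfl⟩)
  | Step.Y :: p, _, 0, _, hl => by simp at hl
  | Step.Y :: p, 0, l + 1, hk, hl => by
      have ih := mem_paths_of_cx_cy p 0 l (by simpa using hk) (by simpa using hl)
      rw [paths_zero_left, List.mem_singleton] at ih
      subst ih
      simp [List.replicate_succ]
  | Step.Y :: p, k + 1, l + 1, hk, hl => by
      have ih := mem_paths_of_cx_cy p (k + 1) l (by simpa using hk) (by simpa using hl)
      rw [paths_succ_succ]
      exact List.mem_append_right _ (List.mem_append_left _ (List.mem_map.2 ⟨p, ih, rfl⟩))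
  | Step.D :: p, 0, _, hk, _ => by simp at hk
  | Step.D :: p, k + 1, 0, _, hl => by simp at hl
  | Step.D :: p, k + 1, l + 1, hk, hl => by
      have ih := mem_paths_of_cx_cy p k l (by simpa using hk) (by simpa using hl)
      rw [paths_succ_succ]
      exact List.mem_append_right _ (List.mem_append_right _ (List.mem_map.2 ⟨p, ih, rfl⟩))

/-- (1) The enumeration is exact: `p ∈ paths k l ↔ cx p = k ∧ cy p = l`. [folklore] -/
theorem mem_paths_iff (k l : ℕ) (p : List Step) : p ∈ paths k l ↔ cx p = k ∧ cy p = l :=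
  ⟨cx_cy_of_mem_paths k l p, fun h => mem_paths_of_cx_cy p k l h.1 h.2⟩

/-! ### No repetition -/

/-- (2) The enumeration has no repetition: the three blocks of Hoffman's recursion are
duplicate-free images of injective maps with pairwise distinct head letters. [folklore] -/
theorem nodup_paths : ∀ k l : ℕ, (paths k l).Nodup
  | 0, l => by rw [paths_zero_left]; exact List.nodup_singleton _
  | k + 1, 0 => by rw [paths_succ_zero]; exact List.nodup_singleton _
  | k + 1, l + 1 => by
      rw [paths_succ_succ]
      refine List.nodup_append.2 ⟨(nodup_paths k (l + 1)).map List.cons_injective,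
        List.nodup_append.2 ⟨(nodup_paths (k + 1) l).map List.cons_injective,
          (nodup_paths k l).map List.cons_injective, ?_⟩, ?_⟩
      · simp only [List.mem_map]
        rintro _ ⟨q, -, rfl⟩ _ ⟨q', -, rfl⟩
        simp
      · simp only [List.mem_map, List.mem_append]
        rintro _ ⟨q, -, rfl⟩ _ (⟨q', -, rfl⟩ | ⟨q', -, rfl⟩) <;> simp

/-! ### The last-step decomposition -/

/-- The last-step blocks `(paths k (l+1))·X ++ (paths (k+1) l)·Y ++ (paths k l)·D` are
duplicate-free (injective maps `(· ++ [σ])`, pairwise distinct last letters). [folklore] -/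
theorem nodup_lastStep (k l : ℕ) :
    ((paths k (l + 1)).map (· ++ [Step.X]) ++
      ((paths (k + 1) l).map (· ++ [Step.Y]) ++ (paths k l).map (· ++ [Step.D]))).Nodup := by
  refine List.nodup_append.2 ⟨(nodup_paths k (l + 1)).map (List.append_left_injective _),
    List.nodup_append.2 ⟨(nodup_paths (k + 1) l).map (List.append_left_injective _),
      (nodup_paths k l).map (List.append_left_injective _), ?_⟩, ?_⟩
  · simp only [List.mem_map]
    rintro _ ⟨q, -, rfl⟩ _ ⟨q', -, rfl⟩
    simp
  · simp only [List.mem_map, List.mem_append]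
    rintro _ ⟨q, -, rfl⟩ _ (⟨q', -, rfl⟩ | ⟨q', -, rfl⟩) <;> simp

/-- Membership in the last-step blocks is again the endpoint condition `cx p = k+1 ∧ cy p = l+1`
(a path with a positive endpoint is nonempty; split off its last letter). [folklore] -/
theorem mem_lastStep_iff (k l : ℕ) (p : List Step) :
    p ∈ ((paths k (l + 1)).map (· ++ [Step.X]) ++
      ((paths (k + 1) l).map (· ++ [Step.Y]) ++ (paths k l).map (· ++ [Step.D]))) ↔
      cx p = k + 1 ∧ cy p = l + 1 := by
  simp only [List.mem_append, List.mem_map, mem_paths_iff]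
  constructor
  · rintro (⟨q, ⟨h1, h2⟩, rfl⟩ | ⟨q, ⟨h1, h2⟩, rfl⟩ | ⟨q, ⟨h1, h2⟩, rfl⟩) <;> simp [h1, h2]
  · rintro ⟨h1, h2⟩
    induction p using List.reverseRecOn with
    | nil => simp at h1
    | append_singleton q a _ =>
      cases a with
      | X =>
        simp only [cx_append, cy_append, cx_cons_X, cy_cons_X, cx_nil, cy_nil] at h1 h2
        exact Or.inl ⟨q, ⟨by omega, by omega⟩, rfl⟩
      | Y =>
        simp only [cx_append, cy_append, cx_cons_Y, cy_cons_Y, cx_nil, cy_nil] at h1 h2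
        exact Or.inr (Or.inl ⟨q, ⟨by omega, by omega⟩, rfl⟩)
      | D =>
        simp only [cx_append, cy_append, cx_cons_D, cy_cons_D, cx_nil, cy_nil] at h1 h2
        exact Or.inr (Or.inr ⟨q, ⟨by omega, by omega⟩, rfl⟩)

/-- (3) The last-step decomposition of the enumeration, up to permutation:
`paths (k+1) (l+1) ~ (paths k (l+1))·X ++ (paths (k+1) l)·Y ++ (paths k l)·D`. [folklore] -/
theorem perm_paths_lastStep (k l : ℕ) :
    (paths (k + 1) (l + 1)).Perm
      ((paths k (l + 1)).map (· ++ [Step.X]) ++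
        ((paths (k + 1) l).map (· ++ [Step.Y]) ++ (paths k l).map (· ++ [Step.D]))) :=
  (List.perm_ext_iff_of_nodup (nodup_paths _ _) (nodup_lastStep k l)).2 fun p => by
    rw [mem_paths_iff, mem_lastStep_iff]

/-- **Stub `stub_pathsCombinatorics`** (combinatorics of lattice paths).  (1) `paths k l`
enumerates EXACTLY the step lists with `k` steps in `{X, D}` and `l` steps in `{Y, D}`;
(2) without repetition; (3) hence the LAST-STEP decomposition holds up to permutation:
`paths (k+1) (l+1) ~ (paths k (l+1))·X ++ (paths (k+1) l)·Y ++ (paths k l)·D`. [folklore] -/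
theorem stub_pathsCombinatorics :
    (∀ (k l : ℕ) (p : List Step), p ∈ paths k l ↔ cx p = k ∧ cy p = l) ∧
    (∀ k l : ℕ, (paths k l).Nodup) ∧
    (∀ k l : ℕ, (paths (k + 1) (l + 1)).Perm
      ((paths k (l + 1)).map (· ++ [Step.X]) ++
        ((paths (k + 1) l).map (· ++ [Step.Y]) ++ (paths k l).map (· ++ [Step.D])))) :=
  ⟨mem_paths_iff, nodup_paths, perm_paths_lastStep⟩

end Summit.KontsevichZagierPeriods.FurushoPentagon.StuffleInKZ
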